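import Mathlib
import HarnessLib
import Literature.Analysis.FluidPDE.NewtonPotentialHolder
import Summits.NavierStokesRegularity.NavierStokesRegularity.Theorems.ChiralWindowDoorDefs
import Summits.NavierStokesRegularity.NavierStokesRegularity.Theorems.CriticalFluxDoorDefs
import Summits.NavierStokesRegularity.NavierStokesRegularity.Theorems.ChiralWindowDoorLambda
import Summits.NavierStokesRegularity.NavierStokesRegularity.Theorems.ChiralWindowDoorFracLapHalfBounds
import Summits.NavierStokesRegularity.NavierStokesRegularity.Theorems.ChiralWindowDoorCurlCommutes
import Summits.NavierStokesRegularity.NavierStokesRegularity.Theorems.CriticalFluxDoorLambdaDeriv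
import Summits.NavierStokesRegularity.NavierStokesRegularity.Theorems.CriticalFluxDoorPressureIBP
import Summits.NavierStokesRegularity.NavierStokesRegularity.Theorems.CriticalFluxDoorCritEnergyDeriv

/-!
# Door S21-C «CriticalFluxDoor» — `Λ` of a COMPACTLY SUPPORTED field (far-field decay `‖x‖⁻⁴`, integrability) and
# `C¹`-regularity of `Λ` of a bounded field (F3 plumbing)

Door S21-C of nsreg-p1's local Type-I door family (`HOME/ns-regularity-ideate-p1/ROUND-20.md`; DESIGN-ONLY, route NOT born).
Two more ingredients of the windowed critical-energy budget (F3-DERIVATION §1–§2): the commutator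
`[Λ,a]v = Λ(a v) − aΛv` is paired against `∂ₜv` over ALL of `ℝ³`, which needs `Λ(a v) ∈ L¹` (and, in the far zone, its
`‖x‖⁻⁴` decay); and the viscous integration by parts `∫a⟪Δv, Λv⟫ = −∑ᵢ∫⟪∂ᵢv, ∂ᵢ(aΛv)⟫` needs `Λv ∈ C¹`.

* `norm_fracLapHalf_le_of_support` — **far field**: `f` integrable, `f = 0` off `B̄_ρ(0)` ⇒ for `‖x‖ ≥ 2ρ`,
  `‖Λf(x)‖ ≤ (16/π²)·‖f‖₁·‖x‖⁻⁴`;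
* `integrable_fracLapHalf_of_hasCompactSupport` — `f ∈ C²_c ⇒ Λf ∈ L¹(ℝ³)`;
* `fracLapHalf_regular_of_bounds` — for `f ∈ C⁴` with bounded `f,…,D⁴f` and `div f = 0`: `Λf` is `C¹`, its partials are
  `∂ₑΛf = Λ∂ₑf`, and `div Λf = 0` (generic form of the tree's door-class `fracLapHalf_slice_regular`).

Seat nsreg-p6 g13 (THEOREMS-ONLY door sequels, DIRECTOR-NS g8 #32 (2)/#36).  WHAT THIS IS NOT: not NS regularity (Clay A);
kernel calculus only; no route is opened.
-/

noncomputable section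

-- the summit and its single sub-problem share the name (CONVENTIONS §1), as in every Theorems file
set_option linter.dupNamespace false

namespace Summit.NavierStokesRegularity.NavierStokesRegularity.Theorems.CriticalFluxDoorLambdaCompact

open MeasureTheory Metric Set Filter Topology Function
open scoped RealInnerProductSpace
open Literature.Analysis Literature.Analysis.FluidPDE
open Summit.NavierStokesRegularity.NavierStokesRegularity.Theorems.ChiralWindowDoorDefs
open Summit.NavierStokesRegularity.NavierStokesRegularity.Theorems.CriticalFluxDoorDefs
open Summit.NavierStokesRegularity.NavierStokesRegularity.Theorems.ChiralWindowDoorLambda (norm_secondDiff_le)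
open Summit.NavierStokesRegularity.NavierStokesRegularity.Theorems.ChiralWindowDoorFracLapHalfBounds
  (continuous_secondDiffOp lamKTrunc_zero)
open Summit.NavierStokesRegularity.NavierStokesRegularity.Theorems.ChiralWindowDoorCurlCommutes (norm_fderiv_two_le)
open Summit.NavierStokesRegularity.NavierStokesRegularity.Theorems.CriticalFluxDoorLambdaDeriv
  (hasFDerivAt_fracLapHalf fderiv_fracLapHalf_apply isDivFree_fracLapHalf)
open Summit.NavierStokesRegularity.NavierStokesRegularity.Theorems.CriticalFluxDoorPressureIBP (bounds_fderiv_apply)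
open Summit.NavierStokesRegularity.NavierStokesRegularity.Theorems.CriticalFluxDoorCritEnergyDeriv
  (norm_fracLapHalf_le_integral_derivDom)

/-! ### Far field of `Λ` of a compactly supported field -/

/-- **Far-field decay**: if `f` is integrable and vanishes off `B̄_ρ(0)` (`ρ > 0`), then for `‖x‖ ≥ 2ρ`
`‖Λf(x)‖ ≤ (16/π²)·(∫‖f‖)·‖x‖⁻⁴` (on the support of `f(x±z)` the kernel sees `‖z‖ ≥ ‖x‖/2`). -/
theorem norm_fracLapHalf_le_of_support {f : EuclideanSpace ℝ (Fin 3) → EuclideanSpace ℝ (Fin 3)}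
    (hfi : Integrable f) {ρ : ℝ} (hρ : 0 < ρ) (hsupp : ∀ y, ρ < ‖y‖ → f y = 0)
    {x : EuclideanSpace ℝ (Fin 3)} (hx : 2 * ρ ≤ ‖x‖) :
    ‖fracLapHalf f x‖ ≤ 16 / Real.pi ^ 2 * (∫ y, ‖f y‖) * (‖x‖ ^ 4)⁻¹ := by
  have hxpos : 0 < ‖x‖ := by linarith
  have hfx : f x = 0 := hsupp x (by linarith)
  set c : ℝ := 16 / Real.pi ^ 2 * (‖x‖ ^ 4)⁻¹ with hc
  have hc0 : 0 ≤ c := by positivity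
  -- kernel bound on the support of the translates
  have hker : ∀ z : EuclideanSpace ℝ (Fin 3), ∀ y : EuclideanSpace ℝ (Fin 3), (y = x + z ∨ y = x - z) →
      lamK z * ‖f y‖ ≤ c * ‖f y‖ := by
    intro z y hy
    by_cases hfy : f y = 0
    · simp [hfy]
    · have hyρ : ‖y‖ ≤ ρ := by
        by_contra h; push Not at h; exact hfy (hsupp y h)
      have hz : ‖x‖ / 2 ≤ ‖z‖ := by
        rcases hy with rfl | rfl
        · have h2 : ‖x‖ ≤ ‖x + z‖ + ‖z‖ := by
            calc ‖x‖ = ‖(x + z) - z‖ := by rw [add_sub_cancel_right]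
              _ ≤ ‖x + z‖ + ‖z‖ := norm_sub_le _ _
          linarith
        · have h2 : ‖x‖ ≤ ‖x - z‖ + ‖z‖ := by
            calc ‖x‖ = ‖(x - z) + z‖ := by rw [sub_add_cancel]
              _ ≤ ‖x - z‖ + ‖z‖ := norm_add_le _ _
          linarith
      have hzpos : 0 < ‖z‖ := by linarith
      refine mul_le_mul_of_nonneg_right ?_ (norm_nonneg _)
      unfold lamK
      rw [hc]
      have h4 : (‖x‖ / 2) ^ 4 ≤ ‖z‖ ^ 4 := pow_le_pow_left₀ (by positivity) hz 4
      have hinv : (‖z‖ ^ 4)⁻¹ ≤ ((‖x‖ / 2) ^ 4)⁻¹ := inv_anti₀ (by positivity) h4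
      calc 1 / Real.pi ^ 2 * (‖z‖ ^ 4)⁻¹ ≤ 1 / Real.pi ^ 2 * ((‖x‖ / 2) ^ 4)⁻¹ :=
            mul_le_mul_of_nonneg_left hinv (by positivity)
        _ = 16 / Real.pi ^ 2 * (‖x‖ ^ 4)⁻¹ := by field_simp; ring
  -- pointwise bound of the integrand
  have hpt : ∀ z, ‖lamK z • ((2 : ℝ) • f x - f (x + z) - f (x - z))‖ ≤ c * ‖f (x + z)‖ + c * ‖f (x - z)‖ := by
    intro z
    rw [hfx, smul_zero, zero_sub, norm_smul, Real.norm_eq_abs, abs_of_nonneg (lamK_nonneg z)]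
    calc lamK z * ‖-f (x + z) - f (x - z)‖ ≤ lamK z * (‖f (x + z)‖ + ‖f (x - z)‖) := by
          refine mul_le_mul_of_nonneg_left ?_ (lamK_nonneg z)
          calc ‖-f (x + z) - f (x - z)‖ ≤ ‖-f (x + z)‖ + ‖f (x - z)‖ := norm_sub_le _ _
            _ = ‖f (x + z)‖ + ‖f (x - z)‖ := by rw [norm_neg]
      _ = lamK z * ‖f (x + z)‖ + lamK z * ‖f (x - z)‖ := by ring
      _ ≤ c * ‖f (x + z)‖ + c * ‖f (x - z)‖ :=
          add_le_add (hker z (x + z) (Or.inl rfl)) (hker z (x - z) (Or.inr rfl))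
  have hgi : Integrable (fun z : EuclideanSpace ℝ (Fin 3) => c * ‖f (x + z)‖ + c * ‖f (x - z)‖) :=
    ((hfi.comp_add_left x).norm.const_mul c).add ((hfi.comp_sub_left x).norm.const_mul c)
  have hI : ∫ z : EuclideanSpace ℝ (Fin 3), (c * ‖f (x + z)‖ + c * ‖f (x - z)‖) = 2 * c * ∫ y, ‖f y‖ := by
    rw [integral_add ((hfi.comp_add_left x).norm.const_mul c) ((hfi.comp_sub_left x).norm.const_mul c),
      integral_const_mul, integral_const_mul]
    have e1 : ∫ z : EuclideanSpace ℝ (Fin 3), ‖f (x + z)‖ = ∫ y, ‖f y‖ := integral_add_left_eq_self (fun y => ‖f y‖) x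
    have e2 : ∫ z : EuclideanSpace ℝ (Fin 3), ‖f (x - z)‖ = ∫ y, ‖f y‖ := integral_sub_left_eq_self (fun y => ‖f y‖) volume x
    rw [e1, e2]; ring
  unfold fracLapHalf
  rw [norm_smul, Real.norm_eq_abs, abs_of_pos (by norm_num : (0 : ℝ) < 1 / 2)]
  calc 1 / 2 * ‖∫ z, lamK z • ((2 : ℝ) • f x - f (x + z) - f (x - z))‖
      ≤ 1 / 2 * ∫ z : EuclideanSpace ℝ (Fin 3), (c * ‖f (x + z)‖ + c * ‖f (x - z)‖) := by
        gcongr; exact norm_integral_le_of_norm_le hgi (ae_of_all _ hpt)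
    _ = c * ∫ y, ‖f y‖ := by rw [hI]; ring
    _ = 16 / Real.pi ^ 2 * (∫ y, ‖f y‖) * (‖x‖ ^ 4)⁻¹ := by rw [hc]; ring

/-! ### Continuity and integrability of `Λ` of a `C²_c` field -/

/-- `f ∈ C²_c ⇒ Λf` is continuous (dominated convergence with the `x`-uniform majorant of the tree's
`…FracLapHalfBounds.continuous_secondDiffOp`). -/
theorem continuous_fracLapHalf_of_hasCompactSupport {f : EuclideanSpace ℝ (Fin 3) → EuclideanSpace ℝ (Fin 3)}
    (hf : ContDiff ℝ 2 f) (hfs : HasCompactSupport f) : Continuous (fracLapHalf f) := by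
  obtain ⟨M₀, h0⟩ := hf.continuous.bounded_above_of_compact_support hfs
  obtain ⟨A, hA⟩ := ((hf.continuous_iteratedFDeriv (m := 2) le_rfl).norm).bounded_above_of_compact_support
    (hfs.iteratedFDeriv 2).norm
  have h2 : ∀ y, ‖iteratedFDeriv ℝ 2 f y‖ ≤ A := fun y => (le_abs_self _).trans ((Real.norm_eq_abs _).symm.le.trans (hA y))
  have h := continuous_secondDiffOp hf.continuous h0 (fun x z => norm_secondDiff_le hf (norm_fderiv_two_le h2) x z) 0
  rw [lamKTrunc_zero] at h
  exact h.const_smul (1 / 2 : ℝ)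

/-- **`f ∈ C²_c ⇒ Λf ∈ L¹(ℝ³)`**: bounded near the support (the `x`-uniform majorant `derivDom`), `O(‖x‖⁻⁴)` far away
(`norm_fracLapHalf_le_of_support`), continuous (dominated convergence). -/
theorem integrable_fracLapHalf_of_hasCompactSupport {f : EuclideanSpace ℝ (Fin 3) → EuclideanSpace ℝ (Fin 3)}
    (hf : ContDiff ℝ 2 f) (hfs : HasCompactSupport f) : Integrable (fracLapHalf f) := by
  obtain ⟨M₀, h0⟩ := hf.continuous.bounded_above_of_compact_support hfs
  obtain ⟨ρ, hρ, hfρ⟩ := hfs.exists_pos_le_norm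
  have hfc : Continuous f := hf.continuous
  have hfi : Integrable f := hfc.integrable_of_hasCompactSupport hfs
  -- second derivatives are bounded (continuous with compact support)
  obtain ⟨A, hA⟩ := ((hf.continuous_iteratedFDeriv (m := 2) le_rfl).norm).bounded_above_of_compact_support
    (hfs.iteratedFDeriv 2).norm
  have h2 : ∀ y, ‖iteratedFDeriv ℝ 2 f y‖ ≤ A := fun y => (le_abs_self _).trans ((Real.norm_eq_abs _).symm.le.trans (hA y))
  -- continuity of `Λf`
  have hΛc : Continuous (fracLapHalf f) := continuous_fracLapHalf_of_hasCompactSupport hf hfs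
  -- the majorant
  set B : ℝ := (1 / 2 : ℝ) * ∫ z, derivDom M₀ A z with hB
  set C : ℝ := 16 / Real.pi ^ 2 * ∫ y, ‖f y‖ with hC
  have hsupp : ∀ y, ρ < ‖y‖ → f y = 0 := fun y hy => hfρ y hy.le
  set G : EuclideanSpace ℝ (Fin 3) → ℝ := fun x =>
    (ball (0 : EuclideanSpace ℝ (Fin 3)) (2 * ρ)).indicator (fun _ => B) x +
      (ball (0 : EuclideanSpace ℝ (Fin 3)) (2 * ρ))ᶜ.indicator (fun x => C * ‖x‖ ^ (-(4 : ℝ))) x with hG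
  have hGi : Integrable G := by
    refine Integrable.add ?_ ?_
    · exact (integrable_indicator_iff measurableSet_ball).2 (integrableOn_const measure_ball_lt_top.ne)
    · rw [integrable_indicator_iff measurableSet_ball.compl]
      exact (NewtonPotentialHolder.integrableOn_compl_ball_norm_rpow_neg (by norm_num) (by positivity)).const_mul C
  refine hGi.mono' hΛc.aestronglyMeasurable (ae_of_all _ fun x => ?_)
  by_cases hx : x ∈ ball (0 : EuclideanSpace ℝ (Fin 3)) (2 * ρ)
  · have hxc : x ∉ (ball (0 : EuclideanSpace ℝ (Fin 3)) (2 * ρ))ᶜ := fun h => h hx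
    rw [hG]; dsimp only
    rw [indicator_of_mem hx, indicator_of_notMem hxc, add_zero]
    exact norm_fracLapHalf_le_integral_derivDom hf h0 h2 x
  · have hxc : x ∈ (ball (0 : EuclideanSpace ℝ (Fin 3)) (2 * ρ))ᶜ := hx
    have hx' : 2 * ρ ≤ ‖x‖ := by simpa [mem_ball, dist_zero_right] using hx
    have hxpos : 0 < ‖x‖ := by linarith
    rw [hG]; dsimp only
    rw [indicator_of_notMem hx, indicator_of_mem hxc, zero_add, Real.rpow_neg hxpos.le,
      show (4 : ℝ) = ((4 : ℕ) : ℝ) by norm_num, Real.rpow_natCast]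
    have h := norm_fracLapHalf_le_of_support hfi hρ hsupp hx'
    rw [hC]
    linarith

/-! ### `C¹`-regularity of `Λ` of a bounded `C⁴` field -/

/-- **Regularity of `Λf`** for `f ∈ C⁴` with `f, Df, …, D⁴f` bounded and `div f = 0`: `Λf` is `C¹`, its partial
derivatives are `∂ₑΛf = Λ(∂ₑf)` and continuous, and `div Λf = 0` (orders 0–3 feed E6/E8, order 4 the continuity of the
partials — the proof of the tree's door-class `fracLapHalf_slice_regular` with hypotheses in place of the class). -/
theorem fracLapHalf_regular_of_bounds {f : EuclideanSpace ℝ (Fin 3) → EuclideanSpace ℝ (Fin 3)} (hf : ContDiff ℝ 4 f)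
    {M₀ M₁ M₂ M₃ M₄ : ℝ} (h0 : ∀ y, ‖f y‖ ≤ M₀) (h1 : ∀ y, ‖iteratedFDeriv ℝ 1 f y‖ ≤ M₁)
    (h2 : ∀ y, ‖iteratedFDeriv ℝ 2 f y‖ ≤ M₂) (h3 : ∀ y, ‖iteratedFDeriv ℝ 3 f y‖ ≤ M₃)
    (h4 : ∀ y, ‖iteratedFDeriv ℝ 4 f y‖ ≤ M₄) (hdiv : VectorCalculus.IsDivFree f) :
    ContDiff ℝ 1 (fracLapHalf f) ∧
      (∀ x e, fderiv ℝ (fracLapHalf f) x e = fracLapHalf (fun y => fderiv ℝ f y e) x) ∧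
      (∀ e : EuclideanSpace ℝ (Fin 3), Continuous fun x => fderiv ℝ (fracLapHalf f) x e) ∧
      VectorCalculus.IsDivFree (fracLapHalf f) := by
  have hcd : ContDiff ℝ 3 f := hf.of_le (by norm_cast)
  have h1' : ∀ y, ‖fderiv ℝ f y‖ ≤ M₁ := fun y => by have := h1 y; rwa [norm_iteratedFDeriv_one] at this
  have hd : Differentiable ℝ (fracLapHalf f) := fun x => (hasFDerivAt_fracLapHalf hcd h0 h1' h2 h3 x).differentiableAt
  have hpart : ∀ x e, fderiv ℝ (fracLapHalf f) x e = fracLapHalf (fun y => fderiv ℝ f y e) x := fun x e =>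
    fderiv_fracLapHalf_apply hcd h0 h1' h2 h3 x e
  have hcont : ∀ e : EuclideanSpace ℝ (Fin 3), Continuous fun x => fderiv ℝ (fracLapHalf f) x e := by
    intro e
    obtain ⟨hg3, g0, g1, g2, g3⟩ := bounds_fderiv_apply hf e h1 h2 h3 h4
    have heq : (fun x => fderiv ℝ (fracLapHalf f) x e) = fracLapHalf (fun y => fderiv ℝ f y e) := funext fun x => hpart x e
    rw [heq]
    exact continuous_iff_continuousAt.2 fun x => (hasFDerivAt_fracLapHalf hg3 g0 g1 g2 g3 x).differentiableAt.continuousAt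
  refine ⟨?_, hpart, hcont, isDivFree_fracLapHalf hcd h0 h1' h2 h3 hdiv⟩
  rw [contDiff_one_iff_fderiv]
  exact ⟨hd, continuous_clm_apply.2 hcont⟩

end Summit.NavierStokesRegularity.NavierStokesRegularity.Theorems.CriticalFluxDoorLambdaCompact

end
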